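import Summits.ValiantsHypothesis.ValiantsHypothesis.Theorems.LacunarySymmetroidMatrixDescartesVLawCoreBoundary

/-!
# `MatrixDescartes` (stmt-ValiantsHypothesis-18050), line `Lift` — the STAR core lemma on the CLOSED kernel window,
# part 2: positivity with boundary letters (`VLawCoreClosed.core_pos₄`)

HONEST FRAMING.  Cell `pub-symmetroid`, seat `val-sym-mdr-p2` (gen 3); helper `--supports` the crux
`Theses.LacunarySymmetroid.MatrixDescartes`, NO closure claim.  Part 1 = `…VLawCoreBoundary.lean` (point-mass divided
differences, four-family entries, bookkeeping).  Consumed by `…FanLawThree.lean` (closed-window fan law).  Nothing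
here bears on `stub_twoSided` in general, the crux in its window, `DoorA26`/`DoorA34`, or `VP ≠ VNP`.

`core_pos₄`: H-form `H(u) = J + (u^a)⁻¹ P + ∑ l, u^{b l} Q l + ∑ m, (u^{c m})⁻¹ R m + ∑ p, u^a B p + ∑ r, ((u^a)^2)⁻¹ E r`
with `J` symmetric, `P, Q l, R m, B p, E r ⪰ 0`, `0 < b l < a` (opposite side, smaller gaps), `a < c m < 2a` (same side,
`c m + b' m = 2a`), `B p` = opposite-side letters with gap EXACTLY `a` (signed ratio `γ = −1`), `E r` = same-side
letters with gap exactly `2a` (`γ = 2`).  Kernel vectors `v j` at pairwise distinct nodes `u j > 0`, LINEARLY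
INDEPENDENT, a target `s > 0` off the nodes with every node's Rayleigh slope
`σ_j = −a(u_j^a)⁻¹P̂ + ∑ b_l u_j^{b_l} Q̂_l − ∑ c_m (u_j^{c_m})⁻¹ R̂_m + ∑ a u_j^a B̂_p − ∑ 2a ((u_j^a)^2)⁻¹ Ê_r` pointing
towards `s` (`0 ≤ (s − u_j)σ_j`), and ONE positive definite companion letter ⇒ the quadratic form of `H(s)` is
positive at every nonzero combination of the `v j`.  Proof = the Gram decomposition of `…VLawCore.core_pos` with two
more (rank-one, point-mass) block families; all blocks and the STAR slack are nonnegative; if the total vanished,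
the positive definite letter's block would vanish, forcing a vanishing linear combination of the `v j` with
coefficients `c_j D_j × (nonzero weight)`, against linear independence.  [folklore]
-/

-- layout Summits/ValiantsHypothesis/ValiantsHypothesis forces the duplicated namespace component
set_option linter.dupNamespace false

namespace Summit.ValiantsHypothesis.ValiantsHypothesis.Theorems.LacunarySymmetroidMatrixDescartes

open MeasureTheory Set Filter Topology Matrix Finset
open scoped BigOperators
open VLawNormalForm VLawCore VLawCoreTwo VLawCoreBoundary

namespace VLawCoreClosed

/-! ## The STAR core lemma on the closed window (strictness from one positive definite companion) -/

section Core

variable {ι : Type*} [Fintype ι] {κ μ ν ξ : Type*} [Fintype κ] [Fintype μ] [Fintype ν] [Fintype ξ]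

/-- **STAR CORE LEMMA, closed window.**  H-form
`H(u) = J + (u^a)⁻¹ P + ∑ l, u^{b l} Q l + ∑ m, (u^{c m})⁻¹ R m + ∑ p, u^a B p + ∑ r, ((u^a)^2)⁻¹ E r`
(`J` symmetric; `P, Q l, R m, B p, E r ⪰ 0`; `0 < b l < a`; `a < c m < 2a` via `c m + b' m = 2a`; the `B p` are the
opposite-side letters with gap EXACTLY `a`, the `E r` the same-side letters with gap exactly `2a`).  Kernel vectors
`v j` of `H(u j)` at pairwise distinct nodes `u j > 0` which are LINEARLY INDEPENDENT, a target `s > 0` off the nodes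
towards which every node's Rayleigh slope points (`0 ≤ (s − u_j)·σ_j`), and ONE positive definite companion letter
(some `Q l`, `R m`, `B p` or `E r`) ⇒ the quadratic form of `H(s)` is positive at every nonzero combination of the
`v j`. [folklore] -/
theorem core_pos₄ [DecidableEq ι] (a : ℕ) (ha : 0 < a) (b n : κ → ℕ) (hnb : ∀ l, n l + b l + 1 = a)
    (hb : ∀ l, 0 < b l) (c n' b' : μ → ℕ) (hnb' : ∀ m, n' m + b' m + 1 = a) (hb' : ∀ m, 0 < b' m)
    (hc : ∀ m, c m + b' m = 2 * a)
    (J P : Matrix ι ι ℝ) (Q : κ → Matrix ι ι ℝ) (R : μ → Matrix ι ι ℝ) (B : ν → Matrix ι ι ℝ)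
    (E : ξ → Matrix ι ι ℝ) (hJ : J.IsSymm) (hP : P.PosSemidef)
    (hQ : ∀ l, (Q l).PosSemidef) (hR : ∀ m, (R m).PosSemidef) (hB : ∀ p, (B p).PosSemidef)
    (hE : ∀ r, (E r).PosSemidef)
    {k : ℕ} (u : Fin k → ℝ) (hu : ∀ j, 0 < u j) (hinj : Function.Injective u) (v : Fin k → ι → ℝ)
    (hli : LinearIndependent ℝ v)
    (hker : ∀ j, (J + ((u j) ^ a)⁻¹ • P + ∑ l, (u j) ^ (b l) • Q l + ∑ m, ((u j) ^ (c m))⁻¹ • R m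
      + ∑ p, (u j) ^ a • B p + ∑ r, (((u j) ^ a) ^ 2)⁻¹ • E r) *ᵥ v j = 0)
    (s : ℝ) (hs : 0 < s) (hsu : ∀ j, s ≠ u j)
    (hstar : ∀ j, 0 ≤ (s - u j) * (-((a : ℝ) * ((u j) ^ a)⁻¹ * (v j ⬝ᵥ (P *ᵥ v j)))
        + ∑ l, (b l : ℝ) * (u j) ^ (b l) * (v j ⬝ᵥ (Q l *ᵥ v j))
        - ∑ m, (c m : ℝ) * ((u j) ^ (c m))⁻¹ * (v j ⬝ᵥ (R m *ᵥ v j))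
        + ∑ p, (a : ℝ) * (u j) ^ a * (v j ⬝ᵥ (B p *ᵥ v j))
        - ∑ r, (2 * a : ℝ) * (((u j) ^ a) ^ 2)⁻¹ * (v j ⬝ᵥ (E r *ᵥ v j))))
    (hPD : (∃ l, (Q l).PosDef) ∨ (∃ m, (R m).PosDef) ∨ (∃ p, (B p).PosDef) ∨ (∃ r, (E r).PosDef))
    (cc : Fin k → ℝ) (hcc : cc ≠ 0) :
    0 < (∑ j, cc j • v j) ⬝ᵥ
      ((J + (s ^ a)⁻¹ • P + ∑ l, s ^ (b l) • Q l + ∑ m, (s ^ (c m))⁻¹ • R m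
        + ∑ p, s ^ a • B p + ∑ r, ((s ^ a) ^ 2)⁻¹ • E r) *ᵥ ∑ j, cc j • v j) := by
  classical
  have hna : ∀ l, n l + 2 ≤ a := fun l => by have := hnb l; have := hb l; omega
  have hna' : ∀ m, n' m + 2 ≤ a := fun m => by have := hnb' m; have := hb' m; omega
  have hPs : P.IsSymm := Matrix.isHermitian_iff_isSymm.1 hP.1
  have hQs : ∀ l, (Q l).IsSymm := fun l => Matrix.isHermitian_iff_isSymm.1 (hQ l).1
  have hRs : ∀ m, (R m).IsSymm := fun m => Matrix.isHermitian_iff_isSymm.1 (hR m).1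
  have hBs : ∀ p, (B p).IsSymm := fun p => Matrix.isHermitian_iff_isSymm.1 (hB p).1
  have hEs : ∀ r, (E r).IsSymm := fun r => Matrix.isHermitian_iff_isSymm.1 (hE r).1
  have hw : ∀ j, 0 < ((u j) ^ a)⁻¹ := fun j => inv_pos.2 (pow_pos (hu j) a)
  have ht : 0 < (s ^ a)⁻¹ := inv_pos.2 (pow_pos hs a)
  have hC : ∀ l, 0 < ∫ ρ in Ioi (0:ℝ), ρ ^ (n l) / (1 + ρ ^ a) :=
    fun l => VLawStieltjes.stieltjesConst_pos (hna l)
  have hC' : ∀ m, 0 < ∫ ρ in Ioi (0:ℝ), ρ ^ (n' m) / (1 + ρ ^ a) :=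
    fun m => VLawStieltjes.stieltjesConst_pos (hna' m)
  have hD : ∀ j, (s ^ a)⁻¹ - ((u j) ^ a)⁻¹ ≠ 0 := by
    intro j h
    exact hsu j ((pow_left_inj₀ hs.le (hu j).le ha.ne').1 (inv_injective (sub_eq_zero.1 h)))
  -- linear independence in coefficient form
  have hli' : ∀ g : Fin k → ℝ, ∑ i, g i • v i = 0 → ∀ i, g i = 0 := Fintype.linearIndependent_iff.1 hli
  -- Step 1: bilinear expansion and the entrywise form
  rw [quadForm_sum_smul]
  have hentry : ∀ i j, v i ⬝ᵥ ((J + (s ^ a)⁻¹ • P + ∑ l, s ^ (b l) • Q l + ∑ m, (s ^ (c m))⁻¹ • R m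
        + ∑ p, s ^ a • B p + ∑ r, ((s ^ a) ^ 2)⁻¹ • E r) *ᵥ v j)
      = (∑ l, (v i ⬝ᵥ (Q l *ᵥ v j)) * (((s ^ a)⁻¹ - ((u i) ^ a)⁻¹) * ((s ^ a)⁻¹ - ((u j) ^ a)⁻¹)
          * (∫ ρ in Ioi (0:ℝ), ρ ^ (n l) / (((u i) ^ a)⁻¹ + ρ ^ a)
              * ((((u j) ^ a)⁻¹ + ρ ^ a)⁻¹ * ((s ^ a)⁻¹ + ρ ^ a)⁻¹))
          / ∫ ρ in Ioi (0:ℝ), ρ ^ (n l) / (1 + ρ ^ a)))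
        + (∑ m, (v i ⬝ᵥ (R m *ᵥ v j)) * (((s ^ a)⁻¹ - ((u i) ^ a)⁻¹) * ((s ^ a)⁻¹ - ((u j) ^ a)⁻¹)
          * (∫ ρ in Ioi (0:ℝ), ρ ^ (n' m) / ((s ^ a)⁻¹ + ρ ^ a)
              * ((ρ ^ a * (((u i) ^ a)⁻¹ + ρ ^ a)⁻¹) * (ρ ^ a * (((u j) ^ a)⁻¹ + ρ ^ a)⁻¹)))
          / ∫ ρ in Ioi (0:ℝ), ρ ^ (n' m) / (1 + ρ ^ a)))
        + (∑ p, (v i ⬝ᵥ (B p *ᵥ v j)) * (((s ^ a)⁻¹ - ((u i) ^ a)⁻¹) * ((s ^ a)⁻¹ - ((u j) ^ a)⁻¹)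
          * ((u i) ^ a * (u j) ^ a * s ^ a)))
        + (∑ r, (v i ⬝ᵥ (E r *ᵥ v j)) * (((s ^ a)⁻¹ - ((u i) ^ a)⁻¹) * ((s ^ a)⁻¹ - ((u j) ^ a)⁻¹)))
        + if i = j then ((s ^ a)⁻¹ - ((u i) ^ a)⁻¹) * (v i ⬝ᵥ (P *ᵥ v i)
            - ∑ l, ((b l : ℝ) / a) * (u i) ^ (a + b l) * (v i ⬝ᵥ (Q l *ᵥ v i))
            + ∑ m, ((c m : ℝ) / a) * (u i) ^ a * ((u i) ^ (c m))⁻¹ * (v i ⬝ᵥ (R m *ᵥ v i))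
            - ∑ p, ((u i) ^ a) ^ 2 * (v i ⬝ᵥ (B p *ᵥ v i))
            + ∑ r, 2 * ((u i) ^ a)⁻¹ * (v i ⬝ᵥ (E r *ᵥ v i))) else 0 := by
    intro i j
    by_cases hij : i = j
    · subst hij
      rw [if_pos rfl]
      exact entry_diag₄ ha hnb hb hnb' hb' hc J P Q R B E (hu i) hs (hker i)
    · rw [if_neg hij, add_zero]
      exact entry_offdiag₄ ha hnb hb hnb' hb' hc hJ hPs hQs hRs hBs hEs (hu i) (hu j) hs
        (fun h => hij (hinj h)) (hker i) (hker j)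
  simp_rw [hentry]
  rw [rearrange₄ cc (fun i => (s ^ a)⁻¹ - ((u i) ^ a)⁻¹)
    (fun i => ((s ^ a)⁻¹ - ((u i) ^ a)⁻¹) * (v i ⬝ᵥ (P *ᵥ v i)
      - ∑ l, ((b l : ℝ) / a) * (u i) ^ (a + b l) * (v i ⬝ᵥ (Q l *ᵥ v i))
      + ∑ m, ((c m : ℝ) / a) * (u i) ^ a * ((u i) ^ (c m))⁻¹ * (v i ⬝ᵥ (R m *ᵥ v i))
      - ∑ p, ((u i) ^ a) ^ 2 * (v i ⬝ᵥ (B p *ᵥ v i))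
      + ∑ r, 2 * ((u i) ^ a)⁻¹ * (v i ⬝ᵥ (E r *ᵥ v i))))
    (fun l i j => v i ⬝ᵥ (Q l *ᵥ v j))
    (fun l i j => ∫ ρ in Ioi (0:ℝ), ρ ^ (n l) / (((u i) ^ a)⁻¹ + ρ ^ a)
        * ((((u j) ^ a)⁻¹ + ρ ^ a)⁻¹ * ((s ^ a)⁻¹ + ρ ^ a)⁻¹))
    (fun l => ∫ ρ in Ioi (0:ℝ), ρ ^ (n l) / (1 + ρ ^ a))
    (fun m i j => v i ⬝ᵥ (R m *ᵥ v j))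
    (fun m i j => ∫ ρ in Ioi (0:ℝ), ρ ^ (n' m) / ((s ^ a)⁻¹ + ρ ^ a)
        * ((ρ ^ a * (((u i) ^ a)⁻¹ + ρ ^ a)⁻¹) * (ρ ^ a * (((u j) ^ a)⁻¹ + ρ ^ a)⁻¹)))
    (fun m => ∫ ρ in Ioi (0:ℝ), ρ ^ (n' m) / (1 + ρ ^ a))
    (fun p i j => v i ⬝ᵥ (B p *ᵥ v j)) (fun i => (u i) ^ a) (s ^ a)
    (fun r i j => v i ⬝ᵥ (E r *ᵥ v j))]
  -- Step 2: the Gram blocks are nonnegative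
  set e : Fin k → ℝ := fun i => cc i * ((s ^ a)⁻¹ - ((u i) ^ a)⁻¹) with he_def
  have hblock : ∀ l, ∑ i, ∑ j, cc i * ((s ^ a)⁻¹ - ((u i) ^ a)⁻¹) * (cc j * ((s ^ a)⁻¹ - ((u j) ^ a)⁻¹))
      * (v i ⬝ᵥ (Q l *ᵥ v j))
      * (∫ ρ in Ioi (0:ℝ), ρ ^ (n l) / (((u i) ^ a)⁻¹ + ρ ^ a) * ((((u j) ^ a)⁻¹ + ρ ^ a)⁻¹ * ((s ^ a)⁻¹ + ρ ^ a)⁻¹))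
      = ∫ ρ in Ioi (0:ℝ), ∑ i, ∑ j, e i * e j * (v i ⬝ᵥ (Q l *ᵥ v j))
        * (ρ ^ (n l) / (((u i) ^ a)⁻¹ + ρ ^ a) * ((((u j) ^ a)⁻¹ + ρ ^ a)⁻¹ * ((s ^ a)⁻¹ + ρ ^ a)⁻¹)) :=
    fun l => (integral_quadForm (hna l) (fun i => ((u i) ^ a)⁻¹) hw ht (Q l) v e).symm
  have hblock' : ∀ m, ∑ i, ∑ j, cc i * ((s ^ a)⁻¹ - ((u i) ^ a)⁻¹) * (cc j * ((s ^ a)⁻¹ - ((u j) ^ a)⁻¹))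
      * (v i ⬝ᵥ (R m *ᵥ v j))
      * (∫ ρ in Ioi (0:ℝ), ρ ^ (n' m) / ((s ^ a)⁻¹ + ρ ^ a)
          * ((ρ ^ a * (((u i) ^ a)⁻¹ + ρ ^ a)⁻¹) * (ρ ^ a * (((u j) ^ a)⁻¹ + ρ ^ a)⁻¹)))
      = ∫ ρ in Ioi (0:ℝ), ∑ i, ∑ j, e i * e j * (v i ⬝ᵥ (R m *ᵥ v j))
        * (ρ ^ (n' m) / ((s ^ a)⁻¹ + ρ ^ a)
          * ((ρ ^ a * (((u i) ^ a)⁻¹ + ρ ^ a)⁻¹) * (ρ ^ a * (((u j) ^ a)⁻¹ + ρ ^ a)⁻¹))) :=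
    fun m => (integral_quadForm₂ (hna' m) (fun i => ((u i) ^ a)⁻¹) hw ht (R m) v e).symm
  have hblockB : ∀ p, ∑ i, ∑ j, cc i * ((s ^ a)⁻¹ - ((u i) ^ a)⁻¹) * (u i) ^ a
        * (cc j * ((s ^ a)⁻¹ - ((u j) ^ a)⁻¹) * (u j) ^ a) * (v i ⬝ᵥ (B p *ᵥ v j))
      = (∑ i, (e i * (u i) ^ a) • v i) ⬝ᵥ (B p *ᵥ ∑ j, (e j * (u j) ^ a) • v j) := by
    intro p
    rw [quadForm_sum_smul]
  have hblockE : ∀ r, ∑ i, ∑ j, cc i * ((s ^ a)⁻¹ - ((u i) ^ a)⁻¹)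
        * (cc j * ((s ^ a)⁻¹ - ((u j) ^ a)⁻¹)) * (v i ⬝ᵥ (E r *ᵥ v j))
      = (∑ i, e i • v i) ⬝ᵥ (E r *ᵥ ∑ j, e j • v j) := by
    intro r
    rw [quadForm_sum_smul]
  have hnonneg : ∀ l (ρ : ℝ), 0 < ρ → 0 ≤ ∑ i, ∑ j, e i * e j * (v i ⬝ᵥ (Q l *ᵥ v j))
      * (ρ ^ (n l) / (((u i) ^ a)⁻¹ + ρ ^ a) * ((((u j) ^ a)⁻¹ + ρ ^ a)⁻¹ * ((s ^ a)⁻¹ + ρ ^ a)⁻¹)) := by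
    intro l ρ hρ
    rw [quadForm_y]
    refine mul_nonneg (mul_nonneg (pow_nonneg hρ.le _) (VLawStieltjes.inv_den_le ht hρ.le).1) ?_
    have h := (hQ l).dotProduct_mulVec_nonneg (∑ j, (e j * (((u j) ^ a)⁻¹ + ρ ^ a)⁻¹) • v j)
    rwa [star_trivial] at h
  have hnonneg' : ∀ m (ρ : ℝ), 0 < ρ → 0 ≤ ∑ i, ∑ j, e i * e j * (v i ⬝ᵥ (R m *ᵥ v j))
      * (ρ ^ (n' m) / ((s ^ a)⁻¹ + ρ ^ a)
        * ((ρ ^ a * (((u i) ^ a)⁻¹ + ρ ^ a)⁻¹) * (ρ ^ a * (((u j) ^ a)⁻¹ + ρ ^ a)⁻¹))) := by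
    intro m ρ hρ
    rw [quadForm_y₂]
    refine mul_nonneg (div_nonneg (pow_nonneg hρ.le _) (VLawStieltjes.den_pos ht a hρ.le).le) ?_
    have h := (hR m).dotProduct_mulVec_nonneg (∑ j, (e j * (ρ ^ a * (((u j) ^ a)⁻¹ + ρ ^ a)⁻¹)) • v j)
    rwa [star_trivial] at h
  have hint_nonneg : ∀ l, 0 ≤ ∫ ρ in Ioi (0:ℝ), ∑ i, ∑ j, e i * e j * (v i ⬝ᵥ (Q l *ᵥ v j))
      * (ρ ^ (n l) / (((u i) ^ a)⁻¹ + ρ ^ a) * ((((u j) ^ a)⁻¹ + ρ ^ a)⁻¹ * ((s ^ a)⁻¹ + ρ ^ a)⁻¹)) :=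
    fun l => setIntegral_nonneg measurableSet_Ioi fun ρ hρ => hnonneg l ρ hρ
  have hint_nonneg' : ∀ m, 0 ≤ ∫ ρ in Ioi (0:ℝ), ∑ i, ∑ j, e i * e j * (v i ⬝ᵥ (R m *ᵥ v j))
      * (ρ ^ (n' m) / ((s ^ a)⁻¹ + ρ ^ a)
        * ((ρ ^ a * (((u i) ^ a)⁻¹ + ρ ^ a)⁻¹) * (ρ ^ a * (((u j) ^ a)⁻¹ + ρ ^ a)⁻¹))) :=
    fun m => setIntegral_nonneg measurableSet_Ioi fun ρ hρ => hnonneg' m ρ hρ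
  have hBnonneg : ∀ p, 0 ≤ (∑ i, (e i * (u i) ^ a) • v i) ⬝ᵥ (B p *ᵥ ∑ j, (e j * (u j) ^ a) • v j) := by
    intro p
    have h := (hB p).dotProduct_mulVec_nonneg (∑ j, (e j * (u j) ^ a) • v j)
    rwa [star_trivial] at h
  have hEnonneg : ∀ r, 0 ≤ (∑ i, e i • v i) ⬝ᵥ (E r *ᵥ ∑ j, e j • v j) := by
    intro r
    have h := (hE r).dotProduct_mulVec_nonneg (∑ j, e j • v j)
    rwa [star_trivial] at h
  -- Step 3: the slack terms are nonnegative (STAR)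
  have hslack_eq : ∀ i, v i ⬝ᵥ (P *ᵥ v i) - ∑ l, ((b l : ℝ) / a) * (u i) ^ (a + b l) * (v i ⬝ᵥ (Q l *ᵥ v i))
        + ∑ m, ((c m : ℝ) / a) * (u i) ^ a * ((u i) ^ (c m))⁻¹ * (v i ⬝ᵥ (R m *ᵥ v i))
        - ∑ p, ((u i) ^ a) ^ 2 * (v i ⬝ᵥ (B p *ᵥ v i))
        + ∑ r, 2 * ((u i) ^ a)⁻¹ * (v i ⬝ᵥ (E r *ᵥ v i))
      = -((u i) ^ a / a) * (-((a : ℝ) * ((u i) ^ a)⁻¹ * (v i ⬝ᵥ (P *ᵥ v i)))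
          + ∑ l, (b l : ℝ) * (u i) ^ (b l) * (v i ⬝ᵥ (Q l *ᵥ v i))
          - ∑ m, (c m : ℝ) * ((u i) ^ (c m))⁻¹ * (v i ⬝ᵥ (R m *ᵥ v i))
          + ∑ p, (a : ℝ) * (u i) ^ a * (v i ⬝ᵥ (B p *ᵥ v i))
          - ∑ r, (2 * a : ℝ) * (((u i) ^ a) ^ 2)⁻¹ * (v i ⬝ᵥ (E r *ᵥ v i))) := by
    intro i
    have ha0 : (a : ℝ) ≠ 0 := by exact_mod_cast ha.ne'
    have hu0 : (u i) ^ a ≠ 0 := (pow_pos (hu i) a).ne'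
    have eP : -((u i) ^ a / a) * (-((a : ℝ) * ((u i) ^ a)⁻¹ * (v i ⬝ᵥ (P *ᵥ v i)))) = v i ⬝ᵥ (P *ᵥ v i) := by
      field_simp
    have eQ : ∀ l, -((u i) ^ a / a) * ((b l : ℝ) * (u i) ^ (b l) * (v i ⬝ᵥ (Q l *ᵥ v i)))
        = -(((b l : ℝ) / a) * (u i) ^ (a + b l) * (v i ⬝ᵥ (Q l *ᵥ v i))) := fun l => by
      rw [pow_add]; field_simp
    have eR : ∀ m, -((u i) ^ a / a) * ((c m : ℝ) * ((u i) ^ (c m))⁻¹ * (v i ⬝ᵥ (R m *ᵥ v i)))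
        = -(((c m : ℝ) / a) * (u i) ^ a * ((u i) ^ (c m))⁻¹ * (v i ⬝ᵥ (R m *ᵥ v i))) := fun m => by
      field_simp
    have eB : ∀ p, -((u i) ^ a / a) * ((a : ℝ) * (u i) ^ a * (v i ⬝ᵥ (B p *ᵥ v i)))
        = -(((u i) ^ a) ^ 2 * (v i ⬝ᵥ (B p *ᵥ v i))) := fun p => by
      field_simp
    have eE : ∀ r, -((u i) ^ a / a) * ((2 * a : ℝ) * (((u i) ^ a) ^ 2)⁻¹ * (v i ⬝ᵥ (E r *ᵥ v i)))
        = -(2 * ((u i) ^ a)⁻¹ * (v i ⬝ᵥ (E r *ᵥ v i))) := fun r => by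
      field_simp
    rw [mul_sub, mul_add, mul_sub, mul_add, Finset.mul_sum, Finset.mul_sum, Finset.mul_sum, Finset.mul_sum]
    simp_rw [eP, eQ, eR, eB, eE, Finset.sum_neg_distrib]
    ring
  have hslack : ∀ i, 0 ≤ ((s ^ a)⁻¹ - ((u i) ^ a)⁻¹) * (v i ⬝ᵥ (P *ᵥ v i)
      - ∑ l, ((b l : ℝ) / a) * (u i) ^ (a + b l) * (v i ⬝ᵥ (Q l *ᵥ v i))
      + ∑ m, ((c m : ℝ) / a) * (u i) ^ a * ((u i) ^ (c m))⁻¹ * (v i ⬝ᵥ (R m *ᵥ v i))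
      - ∑ p, ((u i) ^ a) ^ 2 * (v i ⬝ᵥ (B p *ᵥ v i))
      + ∑ r, 2 * ((u i) ^ a)⁻¹ * (v i ⬝ᵥ (E r *ᵥ v i))) := by
    intro i
    rw [hslack_eq]
    have h := weight_sign (a := a) hs (hu i) (hstar i)
    have hpos : 0 ≤ (u i) ^ a / a := div_nonneg (pow_nonneg (hu i).le a) (Nat.cast_nonneg a)
    have : ((s ^ a)⁻¹ - ((u i) ^ a)⁻¹) * (-((u i) ^ a / a) * (-((a : ℝ) * ((u i) ^ a)⁻¹ * (v i ⬝ᵥ (P *ᵥ v i)))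
          + ∑ l, (b l : ℝ) * (u i) ^ (b l) * (v i ⬝ᵥ (Q l *ᵥ v i))
          - ∑ m, (c m : ℝ) * ((u i) ^ (c m))⁻¹ * (v i ⬝ᵥ (R m *ᵥ v i))
          + ∑ p, (a : ℝ) * (u i) ^ a * (v i ⬝ᵥ (B p *ᵥ v i))
          - ∑ r, (2 * a : ℝ) * (((u i) ^ a) ^ 2)⁻¹ * (v i ⬝ᵥ (E r *ᵥ v i))))
        = ((u i) ^ a / a) * ((((u i) ^ a)⁻¹ - (s ^ a)⁻¹) * (-((a : ℝ) * ((u i) ^ a)⁻¹ * (v i ⬝ᵥ (P *ᵥ v i)))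
          + ∑ l, (b l : ℝ) * (u i) ^ (b l) * (v i ⬝ᵥ (Q l *ᵥ v i))
          - ∑ m, (c m : ℝ) * ((u i) ^ (c m))⁻¹ * (v i ⬝ᵥ (R m *ᵥ v i))
          + ∑ p, (a : ℝ) * (u i) ^ a * (v i ⬝ᵥ (B p *ᵥ v i))
          - ∑ r, (2 * a : ℝ) * (((u i) ^ a) ^ 2)⁻¹ * (v i ⬝ᵥ (E r *ᵥ v i)))) := by ring
    rw [this]
    exact mul_nonneg hpos h
  -- Step 4: nonnegativity of the five parts
  have hAterm : ∀ l, 0 ≤ (∫ ρ in Ioi (0:ℝ), ρ ^ (n l) / (1 + ρ ^ a))⁻¹ *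
      ∑ i, ∑ j, cc i * ((s ^ a)⁻¹ - ((u i) ^ a)⁻¹) * (cc j * ((s ^ a)⁻¹ - ((u j) ^ a)⁻¹))
        * (v i ⬝ᵥ (Q l *ᵥ v j))
        * (∫ ρ in Ioi (0:ℝ), ρ ^ (n l) / (((u i) ^ a)⁻¹ + ρ ^ a)
            * ((((u j) ^ a)⁻¹ + ρ ^ a)⁻¹ * ((s ^ a)⁻¹ + ρ ^ a)⁻¹)) := fun l => by
    rw [hblock l]; exact mul_nonneg (inv_nonneg.2 (hC l).le) (hint_nonneg l)
  have hAterm' : ∀ m, 0 ≤ (∫ ρ in Ioi (0:ℝ), ρ ^ (n' m) / (1 + ρ ^ a))⁻¹ *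
      ∑ i, ∑ j, cc i * ((s ^ a)⁻¹ - ((u i) ^ a)⁻¹) * (cc j * ((s ^ a)⁻¹ - ((u j) ^ a)⁻¹))
        * (v i ⬝ᵥ (R m *ᵥ v j))
        * (∫ ρ in Ioi (0:ℝ), ρ ^ (n' m) / ((s ^ a)⁻¹ + ρ ^ a)
            * ((ρ ^ a * (((u i) ^ a)⁻¹ + ρ ^ a)⁻¹) * (ρ ^ a * (((u j) ^ a)⁻¹ + ρ ^ a)⁻¹))) := fun m => by
    rw [hblock' m]; exact mul_nonneg (inv_nonneg.2 (hC' m).le) (hint_nonneg' m)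
  have hBterm : ∀ p, 0 ≤ s ^ a * ∑ i, ∑ j, cc i * ((s ^ a)⁻¹ - ((u i) ^ a)⁻¹) * (u i) ^ a
        * (cc j * ((s ^ a)⁻¹ - ((u j) ^ a)⁻¹) * (u j) ^ a) * (v i ⬝ᵥ (B p *ᵥ v j)) := fun p => by
    rw [hblockB p]; exact mul_nonneg (pow_pos hs a).le (hBnonneg p)
  have hEterm : ∀ r, 0 ≤ ∑ i, ∑ j, cc i * ((s ^ a)⁻¹ - ((u i) ^ a)⁻¹)
        * (cc j * ((s ^ a)⁻¹ - ((u j) ^ a)⁻¹)) * (v i ⬝ᵥ (E r *ᵥ v j)) := fun r => by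
    rw [hblockE r]; exact hEnonneg r
  have hA : 0 ≤ ∑ l, (∫ ρ in Ioi (0:ℝ), ρ ^ (n l) / (1 + ρ ^ a))⁻¹ *
      ∑ i, ∑ j, cc i * ((s ^ a)⁻¹ - ((u i) ^ a)⁻¹) * (cc j * ((s ^ a)⁻¹ - ((u j) ^ a)⁻¹))
        * (v i ⬝ᵥ (Q l *ᵥ v j))
        * (∫ ρ in Ioi (0:ℝ), ρ ^ (n l) / (((u i) ^ a)⁻¹ + ρ ^ a)
            * ((((u j) ^ a)⁻¹ + ρ ^ a)⁻¹ * ((s ^ a)⁻¹ + ρ ^ a)⁻¹)) :=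
    Finset.sum_nonneg fun l _ => hAterm l
  have hA' : 0 ≤ ∑ m, (∫ ρ in Ioi (0:ℝ), ρ ^ (n' m) / (1 + ρ ^ a))⁻¹ *
      ∑ i, ∑ j, cc i * ((s ^ a)⁻¹ - ((u i) ^ a)⁻¹) * (cc j * ((s ^ a)⁻¹ - ((u j) ^ a)⁻¹))
        * (v i ⬝ᵥ (R m *ᵥ v j))
        * (∫ ρ in Ioi (0:ℝ), ρ ^ (n' m) / ((s ^ a)⁻¹ + ρ ^ a)
            * ((ρ ^ a * (((u i) ^ a)⁻¹ + ρ ^ a)⁻¹) * (ρ ^ a * (((u j) ^ a)⁻¹ + ρ ^ a)⁻¹))) :=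
    Finset.sum_nonneg fun m _ => hAterm' m
  have hAB : 0 ≤ ∑ p, s ^ a * ∑ i, ∑ j, cc i * ((s ^ a)⁻¹ - ((u i) ^ a)⁻¹) * (u i) ^ a
        * (cc j * ((s ^ a)⁻¹ - ((u j) ^ a)⁻¹) * (u j) ^ a) * (v i ⬝ᵥ (B p *ᵥ v j)) :=
    Finset.sum_nonneg fun p _ => hBterm p
  have hAE : 0 ≤ ∑ r, ∑ i, ∑ j, cc i * ((s ^ a)⁻¹ - ((u i) ^ a)⁻¹)
        * (cc j * ((s ^ a)⁻¹ - ((u j) ^ a)⁻¹)) * (v i ⬝ᵥ (E r *ᵥ v j)) :=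
    Finset.sum_nonneg fun r _ => hEterm r
  have hBslack : 0 ≤ ∑ i, cc i ^ 2 * (((s ^ a)⁻¹ - ((u i) ^ a)⁻¹) * (v i ⬝ᵥ (P *ᵥ v i)
      - ∑ l, ((b l : ℝ) / a) * (u i) ^ (a + b l) * (v i ⬝ᵥ (Q l *ᵥ v i))
      + ∑ m, ((c m : ℝ) / a) * (u i) ^ a * ((u i) ^ (c m))⁻¹ * (v i ⬝ᵥ (R m *ᵥ v i))
      - ∑ p, ((u i) ^ a) ^ 2 * (v i ⬝ᵥ (B p *ᵥ v i))
      + ∑ r, 2 * ((u i) ^ a)⁻¹ * (v i ⬝ᵥ (E r *ᵥ v i)))) :=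
    Finset.sum_nonneg fun i _ => mul_nonneg (sq_nonneg _) (hslack i)
  refine lt_of_le_of_ne (add_nonneg (add_nonneg (add_nonneg (add_nonneg hA hA') hAB) hAE) hBslack)
    fun hzero => ?_
  have hA0 := le_antisymm (by linarith) hA
  have hA0' := le_antisymm (by linarith) hA'
  have hAB0 := le_antisymm (by linarith) hAB
  have hAE0 := le_antisymm (by linarith) hAE
  -- a nonzero coefficient, and `e ≠ 0` there
  obtain ⟨i₀, hi₀⟩ := Function.ne_iff.1 hcc
  have he₀ : e i₀ ≠ 0 := mul_ne_zero hi₀ (hD i₀)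
  -- strictness from the positive definite companion letter and linear independence
  rcases hPD with ⟨l, hl⟩ | ⟨m, hm⟩ | ⟨p, hp⟩ | ⟨r, hr⟩
  · -- an open opposite-side letter `Q l ≻ 0`
    have hl0 := (Finset.sum_eq_zero_iff_of_nonneg fun l _ => hAterm l).1 hA0 l (Finset.mem_univ l)
    rw [hblock l, mul_eq_zero] at hl0
    have hI : ∫ ρ in Ioi (0:ℝ), ∑ i, ∑ j, e i * e j * (v i ⬝ᵥ (Q l *ᵥ v j))
        * (ρ ^ (n l) / (((u i) ^ a)⁻¹ + ρ ^ a) * ((((u j) ^ a)⁻¹ + ρ ^ a)⁻¹ * ((s ^ a)⁻¹ + ρ ^ a)⁻¹)) = 0 :=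
      hl0.resolve_left (inv_ne_zero (hC l).ne')
    have hvan := eq_zero_of_integral_eq_zero
      (continuousOn_kernelSum (n l) a hw ht (fun i j => v i ⬝ᵥ (Q l *ᵥ v j)) e) (hnonneg l)
      (integrable_finsetSum _ fun i _ => integrable_finsetSum _ fun j _ =>
        integrableOn_kernel_term (hna l) (hw i) (hw j) ht _) hI
    have h0 := hvan 1 one_pos
    rw [quadForm_y, mul_eq_zero] at h0
    have h1 : (∑ i, (e i * (((u i) ^ a)⁻¹ + 1 ^ a)⁻¹) • v i)
        ⬝ᵥ (Q l *ᵥ ∑ j, (e j * (((u j) ^ a)⁻¹ + 1 ^ a)⁻¹) • v j) = 0 :=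
      h0.resolve_left (mul_ne_zero (pow_pos one_pos _).ne'
        (inv_ne_zero (VLawStieltjes.den_pos ht a zero_le_one).ne'))
    have hy : ∑ i, (e i * (((u i) ^ a)⁻¹ + 1 ^ a)⁻¹) • v i = 0 := by
      by_contra hy
      have hpos := hl.dotProduct_mulVec_pos hy
      rw [star_trivial, h1] at hpos
      exact lt_irrefl 0 hpos
    have h2 := hli' _ hy i₀
    exact (mul_ne_zero he₀ (inv_ne_zero (VLawStieltjes.den_pos (hw i₀) a zero_le_one).ne')) h2
  · -- an open same-side letter `R m ≻ 0`
    have hl0 := (Finset.sum_eq_zero_iff_of_nonneg fun m _ => hAterm' m).1 hA0' m (Finset.mem_univ m)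
    rw [hblock' m, mul_eq_zero] at hl0
    have hI : ∫ ρ in Ioi (0:ℝ), ∑ i, ∑ j, e i * e j * (v i ⬝ᵥ (R m *ᵥ v j))
        * (ρ ^ (n' m) / ((s ^ a)⁻¹ + ρ ^ a)
          * ((ρ ^ a * (((u i) ^ a)⁻¹ + ρ ^ a)⁻¹) * (ρ ^ a * (((u j) ^ a)⁻¹ + ρ ^ a)⁻¹))) = 0 :=
      hl0.resolve_left (inv_ne_zero (hC' m).ne')
    have hvan := eq_zero_of_integral_eq_zero
      (continuousOn_kernelSum₂ (n' m) a hw ht (fun i j => v i ⬝ᵥ (R m *ᵥ v j)) e) (hnonneg' m)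
      (integrable_finsetSum _ fun i _ => integrable_finsetSum _ fun j _ =>
        integrableOn_kernel_term₂ (hna' m) (hw i) (hw j) ht _) hI
    have h0 := hvan 1 one_pos
    rw [quadForm_y₂, mul_eq_zero] at h0
    have h1 : (∑ i, (e i * ((1:ℝ) ^ a * (((u i) ^ a)⁻¹ + 1 ^ a)⁻¹)) • v i)
        ⬝ᵥ (R m *ᵥ ∑ j, (e j * ((1:ℝ) ^ a * (((u j) ^ a)⁻¹ + 1 ^ a)⁻¹)) • v j) = 0 :=
      h0.resolve_left (div_pos (pow_pos one_pos _) (VLawStieltjes.den_pos ht a zero_le_one)).ne'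
    have hy : ∑ i, (e i * ((1:ℝ) ^ a * (((u i) ^ a)⁻¹ + 1 ^ a)⁻¹)) • v i = 0 := by
      by_contra hy
      have hpos := hm.dotProduct_mulVec_pos hy
      rw [star_trivial, h1] at hpos
      exact lt_irrefl 0 hpos
    have h2 := hli' _ hy i₀
    rw [one_pow, one_mul] at h2
    exact (mul_ne_zero he₀ (inv_ne_zero (add_pos (hw i₀) one_pos).ne')) h2
  · -- a boundary opposite-side letter `B p ≻ 0` (gap exactly `a`)
    have hp0 := (Finset.sum_eq_zero_iff_of_nonneg fun p _ => hBterm p).1 hAB0 p (Finset.mem_univ p)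
    rw [hblockB p, mul_eq_zero] at hp0
    have h1 := hp0.resolve_left (pow_pos hs a).ne'
    have hy : ∑ i, (e i * (u i) ^ a) • v i = 0 := by
      by_contra hy
      have hpos := hp.dotProduct_mulVec_pos hy
      rw [star_trivial, h1] at hpos
      exact lt_irrefl 0 hpos
    have h2 := hli' _ hy i₀
    exact (mul_ne_zero he₀ (pow_pos (hu i₀) a).ne') h2
  · -- a boundary same-side letter `E r ≻ 0` (gap exactly `2a`)
    have hr0 := (Finset.sum_eq_zero_iff_of_nonneg fun r _ => hEterm r).1 hAE0 r (Finset.mem_univ r)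
    rw [hblockE r] at hr0
    have hy : ∑ i, e i • v i = 0 := by
      by_contra hy
      have hpos := hr.dotProduct_mulVec_pos hy
      rw [star_trivial, hr0] at hpos
      exact lt_irrefl 0 hpos
    exact he₀ (hli' _ hy i₀)

end Core

end VLawCoreClosed

end Summit.ValiantsHypothesis.ValiantsHypothesis.Theorems.LacunarySymmetroidMatrixDescartes
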